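import Summits.QuantumFields.QCD.Theses.QuarksAsStableAction
import Literature.MathematicalPhysics.QuantumLattice.WilsonDiracAP
import Literature.MathematicalPhysics.QuantumLattice.GrassmannIntegralProofs

/-!
# The Wilson time-projection substitution is unimodular
(helper for crux stmt-QuantumFields-9737 `QuarksAsStableAction.StableActionBridge`, line `Sketch`,
F3-core brick; stub `det_shiftSubst_spin_eq_one`)

In the time-slice / transfer-matrix reduction of the `r = 1` Wilson fermion determinant one
substitutes `ψ_s = P⁻ φ_s + P⁺ φ_{s+1}`, where `P± = ½ (1 ± γ₀)` are the Wilson time projections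
(acting on the spin index only) and `s ∈ ℤ/T` is the time slice.  The substitution matrix
`Σ′ = 1_T ⊗ (1 ⊗ 1 ⊗ P⁻) + S ⊗ (1 ⊗ 1 ⊗ P⁺)` on `ℤ/T × (sites × colour × spin)`, `S` the cyclic time
shift `S t s = [s = t + 1]`, is UNIMODULAR: `det Σ′ = 1` for every `T ≥ 1`
(`det_shiftSubst_spin_eq_one`).

Proof.  In the tree's chiral basis `γ₀ = σʸ ⊗ σˣ` (`euclideanGamma_zero`); the invertible matrix
`H = !![1, 0, 0, -I; 0, 1, -I, 0; 1, 0, 0, I; 0, 1, I, 0]` (rows: left eigenvectors of `γ₀`)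
satisfies `H P⁺ = Q⁺ H`, `H P⁻ = Q⁻ H` with the coordinate projections `Q⁺ = diag (1, 1, 0, 0)`,
`Q⁻ = diag (0, 0, 1, 1)`.  Hence `(1 ⊗ H) Σ′ = Σ″ (1 ⊗ H)` with
`Σ″ = 1 ⊗ (1 ⊗ 1 ⊗ Q⁻) + S ⊗ (1 ⊗ 1 ⊗ Q⁺)`, so `det Σ′ = det Σ″`; and `Σ″` is block diagonal over
`sites × colour × spin` with block `S` on the two `γ₀ = +1` spin components and block `1` on the two
`γ₀ = -1` components, whence `det Σ″ = ((det S)²)^{#sites · #colours} = 1` because `S Sᵀ = 1`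
(a permutation matrix) gives `(det S)² = 1`.  The value of `det S = ±1` is never needed.
[cite: Luscher1977, pp. 283–292] (prose: Smit, *Introduction to Quantum Fields on a Lattice*, §6.5).
Pure theorem file (no definitions): the auxiliary matrices are written as literals.
-/

noncomputable section

namespace Summit.QuantumFields.QCD.Cruxes.StableActionBridge.Sketch

open Literature.MathematicalPhysics.QuantumLattice Literature.MathematicalPhysics.QuantumFieldTheory

namespace ShiftSubstDet

open Complex Matrix
open scoped Kronecker

/-! ### The `4 × 4` spin algebra: diagonalising the Wilson time projections -/

/-- `P⁺ = ½ (1 + γ₀)` written out in the chiral basis (`γ₀ = σʸ ⊗ σˣ`). -/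
theorem projPlus_eq :
    (1 / 2 : ℂ) • (1 + euclideanGamma 0) =
      (1 / 2 : ℂ) • !![1, 0, 0, -I; 0, 1, -I, 0; 0, I, 1, 0; I, 0, 0, 1] := by
  rw [euclideanGamma_zero]
  congr 1
  ext i j
  fin_cases i <;> fin_cases j <;> simp

/-- `P⁻ = ½ (1 - γ₀)` written out in the chiral basis (`γ₀ = σʸ ⊗ σˣ`). -/
theorem projMinus_eq :
    (1 / 2 : ℂ) • (1 - euclideanGamma 0) =
      (1 / 2 : ℂ) • !![1, 0, 0, I; 0, 1, I, 0; 0, -I, 1, 0; -I, 0, 0, 1] := by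
  rw [euclideanGamma_zero]
  congr 1
  ext i j
  fin_cases i <;> fin_cases j <;> simp

/-- `H P⁺ = Q⁺ H`: the rows of `H` are left eigenvectors of `γ₀`, the first two for `+1`. -/
theorem spinH_mul_projPlus :
    (!![1, 0, 0, -I; 0, 1, -I, 0; 1, 0, 0, I; 0, 1, I, 0] : Matrix (Fin 4) (Fin 4) ℂ) *
        ((1 / 2 : ℂ) • (1 + euclideanGamma 0)) =
      !![1, 0, 0, 0; 0, 1, 0, 0; 0, 0, 0, 0; 0, 0, 0, 0] *
        !![1, 0, 0, -I; 0, 1, -I, 0; 1, 0, 0, I; 0, 1, I, 0] := by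
  rw [projPlus_eq, Matrix.mul_smul]
  ext i j
  fin_cases i <;> fin_cases j <;> simp <;> ring

/-- `H P⁻ = Q⁻ H`: the rows of `H` are left eigenvectors of `γ₀`, the last two for `-1`. -/
theorem spinH_mul_projMinus :
    (!![1, 0, 0, -I; 0, 1, -I, 0; 1, 0, 0, I; 0, 1, I, 0] : Matrix (Fin 4) (Fin 4) ℂ) *
        ((1 / 2 : ℂ) • (1 - euclideanGamma 0)) =
      !![0, 0, 0, 0; 0, 0, 0, 0; 0, 0, 1, 0; 0, 0, 0, 1] *
        !![1, 0, 0, -I; 0, 1, -I, 0; 1, 0, 0, I; 0, 1, I, 0] := by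
  rw [projMinus_eq, Matrix.mul_smul]
  ext i j
  fin_cases i <;> fin_cases j <;> simp <;> ring

/-- `H` is invertible: `H (½ Hᴴ) = 1`. -/
theorem spinH_mul_spinHinv :
    (!![1, 0, 0, -I; 0, 1, -I, 0; 1, 0, 0, I; 0, 1, I, 0] : Matrix (Fin 4) (Fin 4) ℂ) *
        ((1 / 2 : ℂ) • !![1, 0, 1, 0; 0, 1, 0, 1; 0, I, 0, -I; I, 0, -I, 0]) = 1 := by
  rw [Matrix.mul_smul]
  ext i j
  fin_cases i <;> fin_cases j <;> simp <;> ring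

/-! ### The cyclic time shift -/

/-- The cyclic time shift `S t s = [s = t + 1]` on `ℤ/T` is orthogonal: `S Sᵀ = 1`. -/
theorem timeShift_mul_transpose (T : ℕ) [NeZero T] :
    (Matrix.of fun t s : ZMod T => if s = t + 1 then (1 : ℂ) else 0) *
        (Matrix.of fun t s : ZMod T => if s = t + 1 then (1 : ℂ) else 0)ᵀ = 1 := by
  ext t u
  simp [Matrix.mul_apply, Matrix.one_apply, eq_comm]

/-- Hence `(det S)² = 1` (the sign of the cyclic shift is never needed). -/
theorem det_timeShift_mul_self (T : ℕ) [NeZero T] :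
    (Matrix.of fun t s : ZMod T => if s = t + 1 then (1 : ℂ) else 0).det *
        (Matrix.of fun t s : ZMod T => if s = t + 1 then (1 : ℂ) else 0).det = 1 := by
  calc (Matrix.of fun t s : ZMod T => if s = t + 1 then (1 : ℂ) else 0).det *
        (Matrix.of fun t s : ZMod T => if s = t + 1 then (1 : ℂ) else 0).det
      = (Matrix.of fun t s : ZMod T => if s = t + 1 then (1 : ℂ) else 0).det *
        (Matrix.of fun t s : ZMod T => if s = t + 1 then (1 : ℂ) else 0)ᵀ.det := by
        rw [Matrix.det_transpose]
    _ = 1 := by rw [← Matrix.det_mul, timeShift_mul_transpose, Matrix.det_one]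

/-! ### Spin lifts `1 ⊗ 1 ⊗ M` and the Kronecker form of the substitution matrix -/

variable {X Y : Type*} [Fintype X] [DecidableEq X] [Fintype Y] [DecidableEq Y]

omit [Fintype X] [Fintype Y] in
/-- Entries of the spin lift `1_X ⊗ 1_Y ⊗ M` of a spin matrix `M`. -/
theorem spinLift_apply (M : Matrix (Fin 4) (Fin 4) ℂ) (a b : X × Y × Fin 4) :
    ((1 : Matrix X X ℂ) ⊗ₖ ((1 : Matrix Y Y ℂ) ⊗ₖ M)) a b =
      if a.1 = b.1 ∧ a.2.1 = b.2.1 then M a.2.2 b.2.2 else 0 := by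
  obtain ⟨x, n, α⟩ := a
  obtain ⟨y, m, β⟩ := b
  by_cases hx : x = y <;> by_cases hn : n = m <;> simp [hx, hn]

omit [Fintype X] [Fintype Y] in
/-- A block-cyclic matrix on `ℤ/T × k` with constant diagonal block `A` and constant shift block `B`
is the Kronecker sum `1 ⊗ A + S ⊗ B`. -/
theorem of_diag_add_shift_eq (T : ℕ) {k : Type*} (A B : Matrix k k ℂ) :
    (Matrix.of fun p q : ZMod T × k =>
        (if q.1 = p.1 then A p.2 q.2 else 0) + (if q.1 = p.1 + 1 then B p.2 q.2 else 0)) =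
      (1 : Matrix (ZMod T) (ZMod T) ℂ) ⊗ₖ A +
        (Matrix.of fun t s : ZMod T => if s = t + 1 then (1 : ℂ) else 0) ⊗ₖ B := by
  ext ⟨t, a⟩ ⟨s, b⟩
  simp [Matrix.one_apply, eq_comm]

/-- **Conjugation step.** If `H Pm = Qm H`, `H Pp = Qp H` and `H` has a right inverse, then
`det (1 ⊗ L Pm + S ⊗ L Pp) = det (1 ⊗ L Qm + S ⊗ L Qp)` for the spin lift `L M = 1 ⊗ 1 ⊗ M` and
any time matrix `S`: indeed `(1 ⊗ L H) (1 ⊗ L Pm + S ⊗ L Pp) = (1 ⊗ L Qm + S ⊗ L Qp) (1 ⊗ L H)` with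
`det (1 ⊗ L H) ≠ 0`. -/
theorem det_kronecker_conj_eq {m n : Type*} [Fintype m] [DecidableEq m] [Fintype n] [DecidableEq n]
    (S : Matrix m m ℂ) {Pm Pp Qm Qp H Hinv : Matrix n n ℂ} (hm : H * Pm = Qm * H)
    (hp : H * Pp = Qp * H) (hH : H * Hinv = 1) :
    ((1 : Matrix m m ℂ) ⊗ₖ ((1 : Matrix X X ℂ) ⊗ₖ ((1 : Matrix Y Y ℂ) ⊗ₖ Pm)) +
          S ⊗ₖ ((1 : Matrix X X ℂ) ⊗ₖ ((1 : Matrix Y Y ℂ) ⊗ₖ Pp))).det =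
      ((1 : Matrix m m ℂ) ⊗ₖ ((1 : Matrix X X ℂ) ⊗ₖ ((1 : Matrix Y Y ℂ) ⊗ₖ Qm)) +
          S ⊗ₖ ((1 : Matrix X X ℂ) ⊗ₖ ((1 : Matrix Y Y ℂ) ⊗ₖ Qp))).det := by
  have hUA :
      (1 : Matrix m m ℂ) ⊗ₖ ((1 : Matrix X X ℂ) ⊗ₖ ((1 : Matrix Y Y ℂ) ⊗ₖ H)) *
          ((1 : Matrix m m ℂ) ⊗ₖ ((1 : Matrix X X ℂ) ⊗ₖ ((1 : Matrix Y Y ℂ) ⊗ₖ Pm)) +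
            S ⊗ₖ ((1 : Matrix X X ℂ) ⊗ₖ ((1 : Matrix Y Y ℂ) ⊗ₖ Pp))) =
        ((1 : Matrix m m ℂ) ⊗ₖ ((1 : Matrix X X ℂ) ⊗ₖ ((1 : Matrix Y Y ℂ) ⊗ₖ Qm)) +
            S ⊗ₖ ((1 : Matrix X X ℂ) ⊗ₖ ((1 : Matrix Y Y ℂ) ⊗ₖ Qp))) *
          (1 : Matrix m m ℂ) ⊗ₖ ((1 : Matrix X X ℂ) ⊗ₖ ((1 : Matrix Y Y ℂ) ⊗ₖ H)) := by
    simp only [mul_add, add_mul, ← Matrix.mul_kronecker_mul, one_mul, mul_one, hm, hp]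
  have hU : ((1 : Matrix m m ℂ) ⊗ₖ ((1 : Matrix X X ℂ) ⊗ₖ ((1 : Matrix Y Y ℂ) ⊗ₖ H))).det ≠ 0 := by
    have h1 : (1 : Matrix m m ℂ) ⊗ₖ ((1 : Matrix X X ℂ) ⊗ₖ ((1 : Matrix Y Y ℂ) ⊗ₖ H)) *
        (1 : Matrix m m ℂ) ⊗ₖ ((1 : Matrix X X ℂ) ⊗ₖ ((1 : Matrix Y Y ℂ) ⊗ₖ Hinv)) = 1 := by
      simp only [← Matrix.mul_kronecker_mul, one_mul, hH, Matrix.one_kronecker_one]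
    have h2 := congrArg Matrix.det h1
    rw [Matrix.det_mul, Matrix.det_one] at h2
    exact left_ne_zero_of_mul_eq_one h2
  have h := congrArg Matrix.det hUA
  rw [Matrix.det_mul, Matrix.det_mul, mul_comm _ (Matrix.det ((1 : Matrix m m ℂ) ⊗ₖ
    ((1 : Matrix X X ℂ) ⊗ₖ ((1 : Matrix Y Y ℂ) ⊗ₖ H))))] at h
  exact mul_left_cancel₀ hU h

/-- **Block step.** With the coordinate projections `Q⁻ = diag (0, 0, 1, 1)`,
`Q⁺ = diag (1, 1, 0, 0)` the matrix `1 ⊗ L Q⁻ + S ⊗ L Q⁺` is block diagonal over `X × Y × Fin 4`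
with block `S` on the spin components `0, 1` and block `1` on the components `2, 3`; so if
`(det S)² = 1` its determinant is `((det S)²)^{#X · #Y} = 1`. -/
theorem det_kronecker_diag_eq_one {m : Type*} [Fintype m] [DecidableEq m] (S : Matrix m m ℂ)
    (hS : S.det * S.det = 1) :
    ((1 : Matrix m m ℂ) ⊗ₖ ((1 : Matrix X X ℂ) ⊗ₖ ((1 : Matrix Y Y ℂ) ⊗ₖ
          (!![0, 0, 0, 0; 0, 0, 0, 0; 0, 0, 1, 0; 0, 0, 0, 1] : Matrix (Fin 4) (Fin 4) ℂ))) +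
        S ⊗ₖ ((1 : Matrix X X ℂ) ⊗ₖ ((1 : Matrix Y Y ℂ) ⊗ₖ
          (!![1, 0, 0, 0; 0, 1, 0, 0; 0, 0, 0, 0; 0, 0, 0, 0] : Matrix (Fin 4) (Fin 4) ℂ)))).det =
      1 := by
  have hblock :
      (1 : Matrix m m ℂ) ⊗ₖ ((1 : Matrix X X ℂ) ⊗ₖ ((1 : Matrix Y Y ℂ) ⊗ₖ
            (!![0, 0, 0, 0; 0, 0, 0, 0; 0, 0, 1, 0; 0, 0, 0, 1] : Matrix (Fin 4) (Fin 4) ℂ))) +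
          S ⊗ₖ ((1 : Matrix X X ℂ) ⊗ₖ ((1 : Matrix Y Y ℂ) ⊗ₖ
            (!![1, 0, 0, 0; 0, 1, 0, 0; 0, 0, 0, 0; 0, 0, 0, 0] : Matrix (Fin 4) (Fin 4) ℂ))) =
        Matrix.blockDiagonal fun k : X × Y × Fin 4 => if k.2.2 = 0 ∨ k.2.2 = 1 then S else 1 := by
    ext ⟨t, x, n, α⟩ ⟨s, y, n', β⟩
    simp only [Matrix.add_apply, Matrix.kroneckerMap_apply,
      Matrix.blockDiagonal_apply, Prod.mk.injEq]
    by_cases hx : x = y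
    · by_cases hn : n = n'
      · subst hx hn
        fin_cases α <;> fin_cases β <;> simp [Matrix.one_apply]
      · simp [hn]
    · simp [hx]
  rw [hblock, Matrix.det_blockDiagonal, Fintype.prod_prod_type, Finset.prod_eq_one]
  intro x _
  rw [Fintype.prod_prod_type, Finset.prod_eq_one]
  intro n _
  rw [Fin.prod_univ_four]
  simp [hS]

end ShiftSubstDet

open scoped Kronecker in
/-- **The Wilson time-projection substitution is unimodular** (stub `det_shiftSubst_spin_eq_one` of
line `Sketch`, F3-core brick): for every `T ≥ 1`, every finite site set `X` and colour number `N`,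
the matrix of `ψ_s = P⁻ φ_s + P⁺ φ_{s+1}` (`P± = ½ (1 ± γ₀)` on spin, `s ∈ ℤ/T`) on
`ℤ/T × (X × Fin N × Fin 4)` has determinant `1`. -/
theorem det_shiftSubst_spin_eq_one :
    ∀ (T : ℕ) [NeZero T] (X : Type) [Fintype X] [DecidableEq X] (N : ℕ),
      (Matrix.of fun p q : ZMod T × (X × Fin N × Fin 4) =>
          (if q.1 = p.1 then
              (Matrix.of fun a b : X × Fin N × Fin 4 =>
                if a.1 = b.1 ∧ a.2.1 = b.2.1 then ((1 / 2 : ℂ) • (1 - euclideanGamma 0)) a.2.2 b.2.2 else 0) p.2 q.2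
            else 0) +
            (if q.1 = p.1 + 1 then
              (Matrix.of fun a b : X × Fin N × Fin 4 =>
                if a.1 = b.1 ∧ a.2.1 = b.2.1 then ((1 / 2 : ℂ) • (1 + euclideanGamma 0)) a.2.2 b.2.2 else 0) p.2 q.2
            else 0)).det = 1 := by
  intro T _ X _ _ N
  have hm : (Matrix.of fun a b : X × Fin N × Fin 4 =>
      if a.1 = b.1 ∧ a.2.1 = b.2.1 then ((1 / 2 : ℂ) • (1 - euclideanGamma 0)) a.2.2 b.2.2 else 0) =
        (1 : Matrix X X ℂ) ⊗ₖ
          ((1 : Matrix (Fin N) (Fin N) ℂ) ⊗ₖ ((1 / 2 : ℂ) • (1 - euclideanGamma 0))) := by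
    ext a b
    rw [ShiftSubstDet.spinLift_apply, Matrix.of_apply]
  have hp : (Matrix.of fun a b : X × Fin N × Fin 4 =>
      if a.1 = b.1 ∧ a.2.1 = b.2.1 then ((1 / 2 : ℂ) • (1 + euclideanGamma 0)) a.2.2 b.2.2 else 0) =
        (1 : Matrix X X ℂ) ⊗ₖ
          ((1 : Matrix (Fin N) (Fin N) ℂ) ⊗ₖ ((1 / 2 : ℂ) • (1 + euclideanGamma 0))) := by
    ext a b
    rw [ShiftSubstDet.spinLift_apply, Matrix.of_apply]
  rw [hm, hp, ShiftSubstDet.of_diag_add_shift_eq,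
    ShiftSubstDet.det_kronecker_conj_eq _ ShiftSubstDet.spinH_mul_projMinus
      ShiftSubstDet.spinH_mul_projPlus ShiftSubstDet.spinH_mul_spinHinv]
  exact ShiftSubstDet.det_kronecker_diag_eq_one _ (ShiftSubstDet.det_timeShift_mul_self T)

end Summit.QuantumFields.QCD.Cruxes.StableActionBridge.Sketch

end
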